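import Summits.BirchSwinnertonDyer.Rank1Residual.X11b.BDPRouteLevelToKummer
import HarnessLib

/-!
# X11b, route p2 — the PROPAGATED condition at the strict place WITHOUT (iv):
# `ker (H¹(K_𝔭, E[p^k]) → H¹(K_𝔭, E[p^∞])) = κ_𝔭(E(K_𝔭)_tors)` (`⊆`), and
# `H¹_{𝓛^{(k)}}(K, E[p^k]) ≤ H¹(G_T, E[p^k]) ∩ loc_𝔭⁻¹ κ_𝔭(E(K_𝔭)_tors)`
# (cell `b2b-bsdres`, sub-cell `multr1-p2`, gen 17)

HONEST FRAMING (cell `b2b-bsdres`, run/shared/lean/b2b/bsd-rank1-residual/, verbatim in every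
file): the goal of the cell is to DELETE the COMBINATION-SHAPED residual classes of the
Birch–Swinnerton-Dyer formula for ALL analytic-rank `≤ 1` elliptic curves over `ℚ` — "full BSD
formula for every rank `≤ 1` curve in class `C`" assembled STRICTLY from published theorems — so
that the rank-`≤ 1` remainder becomes exactly the CONSTRUCTION-SHAPED classes, which are TYPED
(missing-input `Prop`s), NOT attempted. This is not "finishing BSD". Sub-cell
`b2b-bsdres-multr1-p2` (X11b, route p2); a RESEARCH ROUTE; no claim beyond the stated class; X11b
stays CONSTRUCTION-SHAPED; nothing here changes a label; no named fact is minted (theorems only; no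
`sorry`). Continues `BDPRouteLevelToKummer.lean` (gen 15).

## What is here

Gen 15's glue `selmerGroup_acLevelStructure_le_inf` put Castella's level-`k` Selmer group inside
`kummerOutside ∩ ker loc_𝔭` under the hypothesis `E[p^∞](K̄)^{Γ_{K_𝔭}} = 0` ((iv)). Without it the
propagated zero condition at `𝔭`, `ker (H¹(K_𝔭, E[p^k]) → H¹(K_𝔭, E[p^∞]))`, is not `0` but the
image of the TORSION of `E(K_𝔭)` under the local Kummer map (Greenberg LNM 1716 §5; JSW §3.3.1
"the image of the local torsion"):

* `baseChangeGeomPointsEquiv_toGeomPoints` — plumbing: `e(P_geom) = P` read in `E(K̄_E)`.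
* **`connectingClass_eq_localKummerClass`** — the connecting class `δ(Q)` of `Q ∈ E[p^∞](K̄)` with
  `p^k Q` fixed by `Γ_E` IS the local Kummer class of `pointsMap Q` (equality of cocycles).
* **`connectingClass_mem_map_torsion_localKummerMap`**, `ker_map_primaryInclusion_le_map_torsion` —
  `ker (H¹(Γ_E, E[p^k]) → H¹(Γ_E, E[p^∞])) ≤ κ_{p^k,E}((W⁄E)(E)_tors)` (descent of the
  `Γ_E`-fixed point `p^k Q` to a torsion point of `(W⁄E)(E)`).
* **`selmerGroup_acLevelStructure_le_inf_torsion`** — `H¹_{𝓛^{(k)}}(K, E[p^k]) ≤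
  kummerOutside W (p^k) T ⊓ loc_𝔭⁻¹ κ_𝔭(E(K_𝔭)_tors)`, NO hypothesis at `𝔭`; cardinality form
  `finite_and_natCard_selmerGroup_acLevelStructure_le_torsion`.

Consumer: the level bound of route p2's Selmer count without (iv) (`BDPRouteSelmerLevelBoundTorsion`,
Part A with the torsion-valued condition `BDPRouteStrictAtPlaceTorsion`). Nothing booked.

References: [GreenbergLNM1716] §5, proof of Prop. 5.8; [JetchevSkinnerWan2017] Prop. 3.2.1 and
§3.3.1 (arXiv:1512.06894 pp. 10–11); [Howard2004HeegnerKolyvagin] Def. 2.1.1; [SilvermanAEC2009]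
VIII.§2, X.§4.
-/

noncomputable section

open scoped Classical

open CategoryTheory NumberField IsDedekindDomain Field
open Literature.NumberTheory.EllipticCurves Literature.NumberTheory.EllipticCurves.GreenbergSelmer
open Literature.NumberTheory.GaloisRepresentations
open Literature.NumberTheory.GaloisRepresentations.DiscreteGaloisModule (SelmerStructure)
open scoped ContRepresentation

universe u

namespace Summit.BirchSwinnertonDyer.Rank1Residual.X11b.LevelKummer

open Summit.BirchSwinnertonDyer.Rank1Residual.X11b.LocBridge
open Summit.BirchSwinnertonDyer.Rank1Residual.X11b.Levels
open Summit.BirchSwinnertonDyer.Rank1Residual.X11b.AcSelmer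
open WeierstrassCurve (toGeomPoints)

/-! ## §1. The connecting class is the local Kummer class; it comes from a torsion point -/

section Local

variable {K : Type u} [Field K] [CharZero K] (W : WeierstrassCurve K) [W.IsElliptic] (p k : ℕ)
  [Fact p.Prime] (E : Type u) [Field E] [Algebra K E]

omit [CharZero K] [W.IsElliptic] in
/-- Plumbing: for an `E`-rational point `R`, the geometric point `toGeomPoints R` read in `E(K̄_E)`
through `baseChangeGeomPointsEquiv` is `R` mapped along `E → K̄_E`. [folklore] -/
theorem baseChangeGeomPointsEquiv_toGeomPoints (R : (W.baseChange E).toAffine.Point) :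
    W.baseChangeGeomPointsEquiv E (toGeomPoints (W.baseChange E) R) =
      (WeierstrassCurve.Affine.Point.map (W' := W)
        (IsScalarTower.toAlgHom K E (AlgebraicClosure E)) R : localPoints W E) := by
  rcases R with _ | ⟨x, y, h⟩
  · rfl
  · rfl

omit [CharZero K] [W.IsElliptic] [Fact p.Prime] in
/-- `p^k • pointsMap Q` is `Γ_E`-fixed when `p^k • Q` is (equivariance of `pointsMap`). [folklore] -/
theorem zsmul_pointsMap_mem_fixedPoints (Q : W.geomPrimaryTorsion p)
    (hQ : ∀ σ : absoluteGaloisGroup E,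
      GaloisRep.restrictField E (primaryGaloisModule W p) σ (p ^ k • Q) = p ^ k • Q) :
    ((p ^ k : ℕ) : ℤ) • pointsMap W E (Q : W.geomPoints) ∈
      MulAction.fixedPoints (absoluteGaloisGroup E) (localPoints W E) := by
  intro σ
  have hX : pointsMap W E (((p ^ k • Q : W.geomPrimaryTorsion p)) : W.geomPoints) =
      ((p ^ k : ℕ) : ℤ) • pointsMap W E (Q : W.geomPoints) := by
    rw [AddSubgroupClass.coe_nsmul, map_nsmul, natCast_zsmul]
  have h := congrArg (fun x : W.geomPrimaryTorsion p ↦ (x : W.geomPoints)) (hQ σ)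
  rw [GaloisRep.restrictField_apply] at h
  change σ • (((p ^ k : ℕ) : ℤ) • pointsMap W E (Q : W.geomPoints)) =
    ((p ^ k : ℕ) : ℤ) • pointsMap W E (Q : W.geomPoints)
  rw [← hX, ← pointsMap_smul W E σ]
  exact congrArg (pointsMap W E) h

omit [Fact p.Prime] in
/-- **The connecting class IS the local Kummer class.** For `Q ∈ E[p^∞](K̄)` with `p^k • Q` fixed by
`Γ_E`, the connecting class `δ(Q) = [σ ↦ σQ − Q] ∈ H¹(Γ_E, E[p^k](K̄))` of the Kummer sequence
`0 → E[p^k] → E[p^∞] → E[p^∞] → 0` equals the local Kummer class `κ_E(pointsMap Q)` of the point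
`pointsMap Q ∈ E(K̄_E)` (whose `p^k`-multiple is `E`-rational): the two cocycles agree in `E(K̄_E)`.
[cite: SilvermanAEC2009, VIII.§2 and X.§4 (Kummer sequence, diagram (**))]
[cite: GreenbergLNM1716, §5 proof of Prop. 5.8] -/
theorem connectingClass_eq_localKummerClass (Q : W.geomPrimaryTorsion p)
    (hQ : ∀ σ : absoluteGaloisGroup E,
      GaloisRep.restrictField E (primaryGaloisModule W p) σ (p ^ k • Q) = p ^ k • Q)
    (hn : ((p ^ k : ℕ) : ℤ) ≠ 0) :
    connectingClass ((primaryInclusion W p k).restrictField E) (p ^ k)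
        (exists_primaryInclusion_restrictField_eq_of_nsmul_eq_zero W p k E)
        (primaryInclusion_restrictField_injective W p k E) Q hQ =
      W.localKummerClass ((p ^ k : ℕ) : ℤ) hn (pointsMap W E (Q : W.geomPoints))
        (zsmul_pointsMap_mem_fixedPoints W p k E Q hQ) := by
  rw [connectingClass, WeierstrassCurve.localKummerClass]
  refine congrArg (oneCocycleClass _) (Subtype.ext (ContinuousMap.ext fun σ ↦ ?_))
  apply (W.torsionPointsEquiv ((p ^ k : ℕ) : ℤ) (E := E) hn).injective
  apply Subtype.ext
  rw [WeierstrassCurve.coe_torsionPointsEquiv_apply, WeierstrassCurve.coe_torsionPointsEquiv_apply,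
    WeierstrassCurve.pointsMap_localKummerCocycle_apply]
  -- `i (ψ̃ σ) = σQ − Q`, read in `E(K̄)`
  have h0 := nsmul_cobCocycle_apply_eq_zero
      (ρB := GaloisRep.restrictField E (primaryGaloisModule W p)) (p ^ k) hQ
  have h := congrArg (fun x : W.geomPrimaryTorsion p ↦ (x : W.geomPoints))
    (apply_liftCocycle (i := (primaryInclusion W p k).restrictField E) (n := p ^ k)
    (hrange := exists_primaryInclusion_restrictField_eq_of_nsmul_eq_zero W p k E)
    (primaryInclusion_restrictField_injective W p k E)
    (cobCocycle (ρB := GaloisRep.restrictField E (primaryGaloisModule W p)) Q) h0 σ)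
  rw [ContIntertwiningMap.restrictField_apply, coe_primaryInclusion_apply,
    Levels.cobCocycle_apply, AddSubgroupClass.coe_sub, GaloisRep.restrictField_apply] at h
  change pointsMap W E (((liftCocycle _ _ _ _ _ _).1 σ : W.geomTorsion _) : W.geomPoints) = _
  rw [h, map_sub, ← pointsMap_smul W E σ (Q : W.geomPoints)]
  rfl

variable [CharZero E]

/-- **`δ(Q) ∈ κ_{p^k,E}((W⁄E)(E)_tors)`**: the `Γ_E`-fixed point `p^k • pointsMap Q` descends to an
`E`-rational point `R` (tree `exists_map_eq_of_forall_smul_localPoints_eq`), which is TORSION (`Q` is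
`p`-power torsion), and `δ(Q) = κ_E(pointsMap Q) = localKummerMap R`.
[cite: JetchevSkinnerWan2017, §3.3.1 (arXiv:1512.06894 p. 11), "the image of the local torsion"]
[cite: GreenbergLNM1716, §5 proof of Prop. 5.8] -/
theorem connectingClass_mem_map_torsion_localKummerMap (Q : W.geomPrimaryTorsion p)
    (hQ : ∀ σ : absoluteGaloisGroup E,
      GaloisRep.restrictField E (primaryGaloisModule W p) σ (p ^ k • Q) = p ^ k • Q)
    (hn : ((p ^ k : ℕ) : ℤ) ≠ 0) :
    connectingClass ((primaryInclusion W p k).restrictField E) (p ^ k)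
        (exists_primaryInclusion_restrictField_eq_of_nsmul_eq_zero W p k E)
        (primaryInclusion_restrictField_injective W p k E) Q hQ ∈
      (AddCommGroup.torsion (W.baseChange E).toAffine.Point).map
        (W.localKummerMap E hn) := by
  haveI : PerfectField E := PerfectField.ofCharZero
  set X : localPoints W E := pointsMap W E (Q : W.geomPoints) with hX
  have hfix := zsmul_pointsMap_mem_fixedPoints W p k E Q hQ
  -- descent of `p^k • X` to an `E`-rational point `R`
  obtain ⟨R, hR⟩ := exists_map_eq_of_forall_smul_localPoints_eq W E
    (X := ((p ^ k : ℕ) : ℤ) • X) (fun τ ↦ hfix τ)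
  -- `R` is torsion
  obtain ⟨j, hj⟩ := (AddCommGroup.mem_primaryComponent (G := W.geomPoints)).mp Q.2
  have hinj := WeierstrassCurve.Affine.Point.map_injective (W' := W)
    (IsScalarTower.toAlgHom K E (AlgebraicClosure E))
  have hkX : p ^ j • (((p ^ k : ℕ) : ℤ) • X) = 0 := by
    rw [smul_comm, hX, ← (pointsMap W E).map_nsmul, hj, (pointsMap W E).map_zero, smul_zero]
  have hRtors : R ∈ AddCommGroup.torsion (W.baseChange E).toAffine.Point := by
    refine (AddCommGroup.mem_torsion _).mpr (isOfFinAddOrder_iff_nsmul_eq_zero.mpr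
      ⟨p ^ j, pow_pos (Fact.out : p.Prime).pos j, hinj ?_⟩)
    rw [map_nsmul, map_zero, hR]
    exact hkX
  refine ⟨R, hRtors, ?_⟩
  -- `localKummerMap R = κ_E(X) = δ(Q)`
  rw [connectingClass_eq_localKummerClass W p k E Q hQ hn]
  refine W.localKummerMap_eq_localKummerClass E hn R X hfix ?_
  rw [baseChangeGeomPointsEquiv_toGeomPoints, hR]

/-- **The propagated zero condition lies in the Kummer image of the local torsion**:
`ker (H¹(Γ_E, E[p^k]) → H¹(Γ_E, E[p^∞])) ≤ κ_{p^k,E}((W⁄E)(E)_tors)`. With (iv) (`E(K_𝔭)[p] = 0`) the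
right side is `0` and this is gen 15's statement; in general it is what Castella's strict condition
at `𝔭` becomes at level `p^k`. [cite: JetchevSkinnerWan2017, §3.3.1 (arXiv:1512.06894 p. 11)]
[cite: Howard2004HeegnerKolyvagin, Def. 2.1.1 (arXiv:1202.6340 p. 5)] -/
theorem ker_map_primaryInclusion_le_map_torsion (hn : ((p ^ k : ℕ) : ℤ) ≠ 0) :
    (galoisCohomology.map ((primaryInclusion W p k).restrictField E) 1).ker ≤
      (AddCommGroup.torsion (W.baseChange E).toAffine.Point).map (W.localKummerMap E hn) := by
  intro c hc
  obtain ⟨Q, hQ, rfl⟩ :=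
    (map_primaryInclusion_restrictField_eq_zero_iff W p k E c).mp ((AddMonoidHom.mem_ker).mp hc)
  exact connectingClass_mem_map_torsion_localKummerMap W p k E Q hQ hn

end Local

/-! ## §2. `H¹_{𝓛^{(k)}}(K, E[p^k]) ≤ kummerOutside W (p^k) T ⊓ loc_𝔭⁻¹ κ_𝔭(E(K_𝔭)_tors)` -/

section Global

variable {K : Type u} [Field K] [NumberField K] (W : WeierstrassCurve K) [W.IsElliptic] (p k : ℕ)
  [Fact p.Prime] (𝔭 : HeightOneSpectrum (𝓞 K)) (S : Set (HeightOneSpectrum (𝓞 K)))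

/-- **Classes of `H¹_{𝓛^{(k)}}(K, E[p^k])` localise at `𝔭` into `κ_𝔭(E(K_𝔭)_tors)`**, NO hypothesis
on `E(K_𝔭)[p]`: Castella's strict condition at `𝔭`, propagated to `E[p^k]`, is the kernel of
`H¹(K_𝔭, E[p^k]) → H¹(K_𝔭, E[p^∞])`. [cite: Castella2018, Def. 2.2 (arXiv:1704.06608 p. 5)]
[cite: JetchevSkinnerWan2017, §3.3.1 (arXiv:1512.06894 p. 11)] -/
theorem localization_mem_map_torsion_of_mem_selmerGroup_acLevelStructure
    (hn : ((p ^ k : ℕ) : ℤ) ≠ 0)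
    {c : galoisCohomology (W.torsionGaloisModule ((p ^ k : ℕ) : ℤ)) 1}
    (hc : c ∈ (acLevelStructure W p k 𝔭 S).selmerGroup) :
    galoisCohomology.localization (W.torsionGaloisModule ((p ^ k : ℕ) : ℤ)) (Sum.inr 𝔭) 1 c ∈
      (AddCommGroup.torsion (W.baseChange (Place.Completion (Sum.inr 𝔭 : Place K))).toAffine.Point).map
        (W.localKummerMap (Place.Completion (Sum.inr 𝔭 : Place K)) hn) := by
  haveI : CharZero (Place.Completion (Sum.inr 𝔭 : Place K)) := charZero_adicCompletion 𝔭
  have h := (DiscreteGaloisModule.SelmerStructure.mem_selmerGroup_iff _ c).mp hc (Sum.inr 𝔭)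
  rw [acLevelStructure_eq_ker_of W p k 𝔭 S (acStructure_self _ p 𝔭 S)] at h
  exact ker_map_primaryInclusion_le_map_torsion W p k (Place.Completion (Sum.inr 𝔭 : Place K)) hn h

/-- **`H¹_{𝓛^{(k)}}(K, E[p^k]) ≤ kummerOutside W (p^k) T ⊓ loc_𝔭⁻¹ κ_𝔭(E(K_𝔭)_tors)`** for every finite
set of places `T` containing the finite places `v ≠ 𝔭` above `p` or in `Σ` — the finite-level
object bounded by route p2's Parts A♭/B, NO hypothesis at `𝔭`.
[cite: JetchevSkinnerWan2017, Prop. 3.2.1 proof (arXiv:1512.06894 p. 10)]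
[cite: Castella2018, Def. 2.2 (arXiv:1704.06608 p. 5)] -/
theorem selmerGroup_acLevelStructure_le_inf_torsion (T : Finset (Place K))
    (hT : ∀ v : HeightOneSpectrum (𝓞 K), v ≠ 𝔭 →
      (((p : ℕ) : 𝓞 K) ∈ v.asIdeal ∨ v ∈ S) → (Sum.inr v : Place K) ∈ T)
    (hn : ((p ^ k : ℕ) : ℤ) ≠ 0) :
    (acLevelStructure W p k 𝔭 S).selmerGroup ≤
      kummerOutside W (p ^ k) T ⊓
        ((AddCommGroup.torsion
            (W.baseChange (Place.Completion (Sum.inr 𝔭 : Place K))).toAffine.Point).map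
          (W.localKummerMap (Place.Completion (Sum.inr 𝔭 : Place K)) hn)).comap
          (galoisCohomology.localization (W.torsionGaloisModule ((p ^ k : ℕ) : ℤ)) (Sum.inr 𝔭) 1) :=
  fun _ hc ↦ ⟨selmerGroup_acLevelStructure_le_kummerOutside W p k 𝔭 S T hT hc,
    AddSubgroup.mem_comap.mpr
      (localization_mem_map_torsion_of_mem_selmerGroup_acLevelStructure W p k 𝔭 S hn hc)⟩

/-- Cardinality form: with `T` as above and the target finite,
`#H¹_{𝓛^{(k)}}(K, E[p^k]) ≤ #(kummerOutside W (p^k) T ⊓ loc_𝔭⁻¹ κ_𝔭(E(K_𝔭)_tors))` and the level group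
is finite. [cite: JetchevSkinnerWan2017, Prop. 3.2.1 proof (arXiv:1512.06894 p. 10)] -/
theorem finite_and_natCard_selmerGroup_acLevelStructure_le_torsion (T : Finset (Place K))
    (hT : ∀ v : HeightOneSpectrum (𝓞 K), v ≠ 𝔭 →
      (((p : ℕ) : 𝓞 K) ∈ v.asIdeal ∨ v ∈ S) → (Sum.inr v : Place K) ∈ T)
    (hn : ((p ^ k : ℕ) : ℤ) ≠ 0)
    [Finite ↥(kummerOutside W (p ^ k) T ⊓
        ((AddCommGroup.torsion
            (W.baseChange (Place.Completion (Sum.inr 𝔭 : Place K))).toAffine.Point).map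
          (W.localKummerMap (Place.Completion (Sum.inr 𝔭 : Place K)) hn)).comap
          (galoisCohomology.localization (W.torsionGaloisModule ((p ^ k : ℕ) : ℤ)) (Sum.inr 𝔭) 1))] :
    Finite (acLevelStructure W p k 𝔭 S).selmerGroup ∧
      Nat.card (acLevelStructure W p k 𝔭 S).selmerGroup ≤
        Nat.card ↥(kummerOutside W (p ^ k) T ⊓
          ((AddCommGroup.torsion
              (W.baseChange (Place.Completion (Sum.inr 𝔭 : Place K))).toAffine.Point).map
            (W.localKummerMap (Place.Completion (Sum.inr 𝔭 : Place K)) hn)).comap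
            (galoisCohomology.localization (W.torsionGaloisModule ((p ^ k : ℕ) : ℤ)) (Sum.inr 𝔭) 1)) :=
  have hle := selmerGroup_acLevelStructure_le_inf_torsion W p k 𝔭 S T hT hn
  ⟨Finite.of_injective _ (AddSubgroup.inclusion_injective hle), AddSubgroup.card_le_of_le hle⟩

end Global

end Summit.BirchSwinnertonDyer.Rank1Residual.X11b.LevelKummer

end
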